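import Summits.BirchSwinnertonDyer.BirchSwinnertonDyer.Theorems.EisensteinPrimesIndexPlumbingLambdaLE
import Summits.BirchSwinnertonDyer.BirchSwinnertonDyer.Theorems.EisensteinPrimesSplitMultLocalHZero
import HarnessLib

/-!
# Crux 4 `BSDpOnCellC` (stmt-BirchSwinnertonDyer-19034), line b1 — the SPLIT conjunct of the wall `stub_imprimitiveCount`:
# the «nr versus strict at `v̄`» PLUMBING of the x1 V21 index road AT A SPLIT MULTIPLICATIVE `v̄`, orientation (ω, 𝟙) —
# `λ(𝔛^{S₀}_nr(θsub)) = corank R(θsub)`, `λ(𝔛^{S₀}_nr(θquot)) ≤ corank R(θquot) + p^c`, and the `λ`-inequality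
# `λ(DSsub.X) + λ(DSquot.X) ≤ λ(𝔛^{Sf}_f) + [θquot = 𝟙]` from the mid-level index identity

Cell `bsd-eis` (run/shared/lean/pub/bsd-eis/), width seat `bsd-line-x2-p2` gen 10 (`--supports -19034`, closes nothing; skeleton of
record b1 v12 sha256 155e218d… UNCHANGED, W-79). Sequel of `EisensteinPrimesSplitMultLocalHZero` (p672062).

WHY. The x1 cell's `IndexPlumbingNrVsStrict.lambdaInvariant_add_le_of_mid` (width seat x1-p1-w8) turns the MID-LEVEL identity
`zpCorank R(E_K[p^∞]) + ε = zpCorank R((F/𝒪)(θsub)) + zpCorank R((F/𝒪)(θquot)) + p^c` of `ResidualIndexAssembly.zpCorank_datumStrictSelmer_add_eq`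
into Keller–Yin's `λ`-inequality through two character-level facts it derived from `Anom W p` + «no unramified rational line»: (B2)
`θsub` is RAMIFIED at `v̄` (so `H¹_{𝓕_Gr} = H¹_{𝓕_nr}` for `(F/𝒪)(θsub)`), (B1) `D_v̄` acts TRIVIALLY on `(F/𝒪)(θquot)` (so the unramified local
kernel above `v̄` has corank `≤ p^c`). At a SPLIT multiplicative Eisenstein prime with the residual line oriented as the Tate line
(«`θsub` non-trivial on `I_v̄`») both facts hold again; this file states them on the split binders and re-assembles the inequality:

* §1 `unitChar_quot_eq_one_of_mem_decomp_of_split`, `smul_charModule_quot_eq_of_mem_decomp_of_split` — `θquot(g) = 1` and `g • x = x` on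
  `(F/𝒪)(θquot)` for every `g ∈ D_v̄` (from p672062's `trivQuot_and_cycSub_of_exists_unitChar_ne_one`: `D_v̄` is trivial on `E_K[p]/Φ`, which
  embeds in `(F/𝒪)(θquot)`; a Teichmüller unit `≠ 1` fixes nothing);
* §2 (B2) CHARACTER-LEVEL, no curve: `lambdaInvariant_eq_zpCorank_grSelmer_of_ramified` — for ANY Teichmüller character `θ` with some
  `τ ∈ I_v̄`, `θ(τ) ≠ 1`, and any f.g. torsion `μ = 0` dual datum `DS` of `H¹_{𝓕_nr^{S₀}}(K_∞, (F/𝒪)(θ))`: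
  `λ(DS.X) = zpCorank H¹_{𝓕_Gr^{S₀}}(K_∞, (F/𝒪)(θ))` (x1-w4's `grSelmer_charModule_eq_unrSelmer_of_ramified` + `λ = corank`);
* §3 (B1) `lambdaInvariant_le_zpCorank_grSelmer_add_pow_quot_of_split` — x1-w8's generic `lambdaInvariant_le_zpCorank_grSelmer_add_pow` fed §1
  and the anticyclotomic generator of `ker κ ⊓ D_v̄` modulo inertia;
* §4 `lambdaInvariant_add_le_of_mid_split` — the `λ`-inequality from the mid-level identity at the SPLIT datum (x1's statement with
  `Anom`/`hlat` replaced by: `p` SPLIT multiplicative, `(p)` split in `K`, `∃ τ ∈ I_v̄, θsub(τ) ≠ 1`; the imprimitivity set `Sf` keeps x1's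
  convention `w ∈ Sf ↔ N ∈ w` — at `p ∣ N` it CONTAINS the places above `p`, which no Selmer object of the road sees (every «outside
  `S`» condition is imposed only at `w ∤ p`); the transfer to line b1's `Sf` (places over `N` off `p`) is a later brick).

HONEST FRAMING: helper theorems only (0 defs, 0 named facts, 0 sorry); UNCONDITIONAL; the mid-level identity is a HYPOTHESIS of §4
(it is the content of the ∃-package + `ResidualIndexAssembly`, next bricks); closes no stub; no summit statement / BSD / MC / IMC / KY
Thm. 1.4.1 (iii) is proved for any curve; 0 cells / labels / tiers move.

References: [KellerYin2024] §1.2 Lemma 1.2.4, Rem. 1.2.2, §1.3 Prop. 1.3.1, §1.4 Thm. 1.4.1 (iii) (arXiv:2402.12781v2 TeX L790–795,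
L1087–1098, L1240–1260), §5.1; [GreenbergVatsal2000] §2 pp. 14–15, 20–21; [Greenberg1989] §1 p. 98; [GreenbergLNM1716] §1 p. 60; the x1
road memo `Cruxes/GoodLatticeBDPValue/Lines/halves-imprimLambda-index-road.md` §2 (7)–(9).
-/

set_option autoImplicit false
-- the route's Theorems namespace repeats the summit name by design (D-0017 nested layout)
set_option linter.dupNamespace false

noncomputable section

open scoped Classical AddSubgroup

namespace Summit.BirchSwinnertonDyer.BirchSwinnertonDyer.Theorems.SplitMultIndexPlumbing

open Function NumberField IsDedekindDomain Field WeierstrassCurve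
  Literature.NumberTheory.EllipticCurves Literature.NumberTheory.EllipticCurves.GreenbergSelmer
  Literature.NumberTheory.EllipticCurves.GreenbergVatsal2000 Literature.NumberTheory.GaloisRepresentations
  Literature.NumberTheory.EllipticCurves.KellerYin2024 Literature.NumberTheory.IwasawaTheory
  Literature.NumberTheory.EllipticCurves.Rank1Residual Literature.NumberTheory.EllipticCurves.Castella2018
  Summit.BirchSwinnertonDyer.Rank1Residual Summit.BirchSwinnertonDyer.Rank1Residual.X2.ResidualDevissageModules
  Summit.BirchSwinnertonDyer.BirchSwinnertonDyer.Theorems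
  Summit.BirchSwinnertonDyer.BirchSwinnertonDyer.Theorems.IndexPlumbingNrVsStrict

/-! ## §1. Orientation (ω, 𝟙): `D_v̄` acts trivially on `(F/𝒪)(θquot)` -/

section QuotTrivial

variable (W : WeierstrassCurve ℚ) [W.IsElliptic] [W.IsGloballyMinimal] {p : ℕ} [hp : Fact p.Prime]
  (K : Type) [Field K] [NumberField K] (vbar : HeightOneSpectrum (𝓞 K))

/-- **`unitChar θquot g = 1` for every `g ∈ D_v̄` at a SPLIT multiplicative `v̄`, orientation (ω, 𝟙).** `W/ℚ` globally minimal with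
SPLIT multiplicative reduction at `p`, `K` imaginary quadratic with `(p)` split, `v̄ ∋ p`, `(θsub, θquot)` a residual pair of `E_K[p]`, and
some `τ ∈ D_v̄` with `θsub(τ) ≠ 1`: then `D_v̄` is trivial on `E_K[p]/Φ` (p672062), which embeds equivariantly in `(F/𝒪)(θquot)`
(`ResidualPairStableLine.exists_stableLine_of_isResidualPairOver`); a `g` with `unitChar θquot g ≠ 1` would fix only `0` there
(`eq_zero_of_smul_eq_of_hom`). «`θquot|_{G_v̄} = 𝟙`». [cite: GreenbergVatsal2000, §2 pp. 14–15]
[cite: KellerYin2024, Prop. 1.3.1 and §1.4 display (char to f) (arXiv:2402.12781v2 TeX L877, L1063–1087)] -/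
theorem unitChar_quot_eq_one_of_mem_decomp_of_split
    (hsplitred : W.HasSplitMultiplicativeReductionAtPrime p) (hK : IsImaginaryQuadratic K)
    (hsplit : ((Ideal.span {(p : ℤ)}).primesOver (𝓞 K)).ncard = 2) (hvbar : ((p : ℕ) : 𝓞 K) ∈ vbar.asIdeal)
    {θsub θquot : FramedGaloisRep K (padicCoeffIntegers (∅ : Set (PadicAlgCl p))) 1}
    (hpair : IsResidualPairOver (W.baseChange K) p θsub θquot)
    (hram : ∃ τ ∈ decomp vbar, unitChar θsub τ ≠ 1)
    {g : absoluteGaloisGroup K} (hg : g ∈ decomp vbar) : unitChar θquot g = 1 := by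
  have hpr : p.Prime := hp.out
  haveI hEK : (W.baseChange K).IsElliptic := inferInstanceAs (W.map (algebraMap ℚ K)).IsElliptic
  have hθsub : ∀ σ : absoluteGaloisGroup K, θsub σ ^ (p - 1) = 1 := fun σ ↦ (hpair.pow_sub_one σ).1
  have hθquot : ∀ σ : absoluteGaloisGroup K, θquot σ ^ (p - 1) = 1 := fun σ ↦ (hpair.pow_sub_one σ).2
  obtain ⟨Φ, hSub, -, ⟨j₁, hj₁, hj₁inj, -⟩, ⟨j₃, hj₃, hj₃inj, -⟩⟩ :=
    ResidualPairStableLine.exists_stableLine_of_isResidualPairOver (W.baseChange K) hpair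
  obtain ⟨hQuot, -, hquot⟩ := SplitMultLocalHZero.trivQuot_and_cycSub_of_exists_unitChar_ne_one W K vbar hsplitred hK hsplit
    hvbar θsub hθsub Φ hSub j₁ hj₁ hj₁inj hram
  -- `Φ.Quot` has a non-zero element (order `p`)
  haveI : Finite Φ.Quot := Nat.finite_of_card_ne_zero (by rw [hQuot]; exact hpr.ne_zero)
  have hnt : Nontrivial Φ.Quot := by
    rw [← Finite.one_lt_card_iff_nontrivial, hQuot]
    exact hpr.one_lt
  obtain ⟨y₀, hy₀⟩ := exists_ne (0 : Φ.Quot)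
  by_contra hne1
  exact hy₀ (CharResidualSelmerCount.eq_zero_of_smul_eq_of_hom θquot hθquot j₃ hj₃ hj₃inj hne1 (hquot g hg y₀))

/-- **`D_v̄` acts trivially on `(F/𝒪)(θquot)`** at a SPLIT multiplicative `v̄`, orientation (ω, 𝟙) (same hypotheses): V21 step (8),
`A_1^{I_j} = A_1 = F/𝒪` with TRIVIAL action of `G_j`, whence `λ_nr(𝟙̃) = λ_str(𝟙̃) + s`. The `htriv` input of x1-w8's generic
`lambdaInvariant_le_zpCorank_grSelmer_add_pow`. [cite: KellerYin2024, §1.4 (arXiv:2402.12781v2 TeX L1240–1260) and Rem. 1.2.2]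
[cite: GreenbergVatsal2000, §2 pp. 14–15] -/
theorem smul_charModule_quot_eq_of_mem_decomp_of_split
    (hsplitred : W.HasSplitMultiplicativeReductionAtPrime p) (hK : IsImaginaryQuadratic K)
    (hsplit : ((Ideal.span {(p : ℤ)}).primesOver (𝓞 K)).ncard = 2) (hvbar : ((p : ℕ) : 𝓞 K) ∈ vbar.asIdeal)
    {θsub θquot : FramedGaloisRep K (padicCoeffIntegers (∅ : Set (PadicAlgCl p))) 1}
    (hpair : IsResidualPairOver (W.baseChange K) p θsub θquot)
    (hram : ∃ τ ∈ decomp vbar, unitChar θsub τ ≠ 1)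
    {g : absoluteGaloisGroup K} (hg : g ∈ decomp vbar) (x : charModule (∅ : Set (PadicAlgCl p)) θquot) : g • x = x := by
  obtain ⟨z, rfl⟩ := (charModuleEquiv θquot).symm.surjective x
  rw [CharResidualSelmerFinite.galois_smul_charModuleEquiv_symm,
    unitChar_quot_eq_one_of_mem_decomp_of_split W K vbar hsplitred hK hsplit hvbar hpair hram hg, Units.val_one, one_smul]

end QuotTrivial

/-! ## §2. (B2) at the character level: `λ(𝔛^{S₀}_nr(θ)) = corank_{ℤ_p} H¹_{𝓕_Gr^{S₀}}(K_∞, (F/𝒪)(θ))` for `θ` RAMIFIED at `v̄` -/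

section SubRamified

variable {K : Type} [Field K] [NumberField K] {p : ℕ} [hp : Fact p.Prime] (κ : ZpExtension K p)
  (vbar : HeightOneSpectrum (𝓞 K)) (S₀ : Set (HeightOneSpectrum (𝓞 K)))
  (θ : FramedGaloisRep K (padicCoeffIntegers (∅ : Set (PadicAlgCl p))) 1)

/-- **(B2), character level: `λ(DS.X) = zpCorank H¹_{𝓕_Gr^{S₀}}(K_∞, (F/𝒪)(θ))`** for a Teichmüller character `θ` (`θ^{p−1} = 1`)
RAMIFIED at `v̄` (some `τ ∈ I_v̄` has `θ(τ) ≠ 1`), EVERY `ℤ_p`-extension `κ`, every `S₀`, and any Pontryagin-dual datum `DS` of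
`H¹_{𝓕_nr^{S₀}}(K_∞, (F/𝒪)(θ))` that is finitely generated `Λ`-torsion with `μ = 0`: `λ = corank_{ℤ_p}` of the character group
(`X2.NonPrimitiveSelmerCorank.finite_torsionBy_and_zpCorank_eq_lambdaInvariant`) and strict = unramified at `v̄` for a ramified character
(x1-w4's `grSelmer_charModule_eq_unrSelmer_of_ramified`). No curve, no reduction hypothesis: x1-w8's `lambdaInvariant_eq_zpCorank_grSelmer_sub`
with its `Anom`-derived inertia element made a hypothesis. [cite: KellerYin2024, proof of Lemma 1.2.4 and Thm. 1.4.1 (iii) (arXiv:2402.12781v2 TeX L790–795, L1087–1098)]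
[cite: GreenbergLNM1716, §1 p. 60] -/
theorem lambdaInvariant_eq_zpCorank_grSelmer_of_ramified (hθ : ∀ σ : absoluteGaloisGroup K, θ σ ^ (p - 1) = 1)
    (hramI : ∃ τ ∈ inertia vbar, unitChar θ τ ≠ 1) {γ : absoluteGaloisGroup K}
    (DS : DatumDualData κ γ (charModule (∅ : Set (PadicAlgCl p)) θ)
      (AcSelmer.bdpData (charModule (∅ : Set (PadicAlgCl p)) θ) p vbar) S₀)
    [Module.Finite (IwasawaAlgebra p) DS.X] (htor : Module.IsTorsion (IwasawaAlgebra p) DS.X)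
    (hμ : muInvariant p DS.X = 0) :
    lambdaInvariant p DS.X = zpCorank ↥(grSelmer κ (charModule (∅ : Set (PadicAlgCl p)) θ) vbar S₀) p := by
  obtain ⟨τ, hτ, hne1⟩ := hramI
  have hprimU : ∀ u : ↥(unrSelmer κ (charModule (∅ : Set (PadicAlgCl p)) θ) vbar S₀), ∃ n : ℕ, p ^ n • u = 0 :=
    fun u ↦ by
      obtain ⟨n, hn⟩ := GreenbergSelmer.exists_pow_smul_subgroupH1_eq_zero κ (charModule (∅ : Set (PadicAlgCl p)) θ)
        (GreenbergSelmer.exists_pow_smul_cofree_eq_zero (∅ : Set (PadicAlgCl p)) θ)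
        (u : subgroupH1 κ.kerSubgroup (charModule (∅ : Set (PadicAlgCl p)) θ))
      exact ⟨n, Subtype.ext (by rw [AddSubgroupClass.coe_nsmul]; exact hn)⟩
  obtain ⟨-, hcork⟩ :=
    X2.NonPrimitiveSelmerCorank.finite_torsionBy_and_zpCorank_eq_lambdaInvariant p DS.X htor hμ hprimU DS.toDualEquiv
  rw [← hcork, CharResidualSelmerCount.grSelmer_charModule_eq_unrSelmer_of_ramified κ vbar S₀ θ hθ hτ hne1]

/-- **(B2) with the cotorsion facts in the line's `∀ D` form** (`hS : ∀ D, Module.Finite ∧ IsTorsion ∧ μ = 0` — on line b1 an input of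
[BR]-type at the character `θsub`), instantiated at `DS`. [cite: KellerYin2024, Thm. 1.4.1 (i)–(iii) (arXiv:2402.12781v2 TeX L1087–1098)] -/
theorem lambdaInvariant_eq_zpCorank_grSelmer_of_ramified_of_forall (hθ : ∀ σ : absoluteGaloisGroup K, θ σ ^ (p - 1) = 1)
    (hramI : ∃ τ ∈ inertia vbar, unitChar θ τ ≠ 1) {γ : absoluteGaloisGroup K}
    (DS : DatumDualData κ γ (charModule (∅ : Set (PadicAlgCl p)) θ)
      (AcSelmer.bdpData (charModule (∅ : Set (PadicAlgCl p)) θ) p vbar) S₀)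
    (hS : ∀ D : DatumDualData κ γ (charModule (∅ : Set (PadicAlgCl p)) θ)
        (AcSelmer.bdpData (charModule (∅ : Set (PadicAlgCl p)) θ) p vbar) S₀,
      Module.Finite (IwasawaAlgebra p) D.X ∧ Module.IsTorsion (IwasawaAlgebra p) D.X ∧ muInvariant p D.X = 0) :
    lambdaInvariant p DS.X = zpCorank ↥(grSelmer κ (charModule (∅ : Set (PadicAlgCl p)) θ) vbar S₀) p := by
  obtain ⟨hfg, htor, hμ⟩ := hS DS
  haveI := hfg
  exact lambdaInvariant_eq_zpCorank_grSelmer_of_ramified κ vbar S₀ θ hθ hramI DS htor hμ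

end SubRamified

/-! ## §3. (B1) at the split datum: `λ(𝔛^{S₀}_nr(θquot)) ≤ corank_{ℤ_p} R((F/𝒪)(θquot)) + p^c` -/

section QuotBound

variable (W : WeierstrassCurve ℚ) [W.IsElliptic] [W.IsGloballyMinimal] {p : ℕ} [hp : Fact p.Prime]
  {K : Type} [Field K] [NumberField K] (κ : ZpExtension K p)

/-- **(B1) at a SPLIT multiplicative `v̄`, orientation (ω, 𝟙): KY §1.4 «nr versus strict at `v̄`» for `θquot`, `≤` direction.** `W/ℚ`
globally minimal, `p ≠ 2` SPLIT multiplicative, `K` imaginary quadratic with `(p)` split, `v̄ ∋ p`, `κ` the anticyclotomic `ℤ_p`-extension,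
`(θsub, θquot)` a residual pair of `E_K[p]` with some `τ ∈ D_v̄`, `θsub(τ) ≠ 1`; `τ i` (`i < p^c`) representatives controlling the strict
condition above `v̄` for `(F/𝒪)(θquot)`; `DSquot` any dual datum of `H¹_{𝓕_nr^{S₀}}(K_∞, (F/𝒪)(θquot))`, f.g. `Λ`-torsion with `μ = 0`.
Then `λ(DSquot.X) ≤ zpCorank (grSelmer κ (charModule ∅ θquot) v̄ S₀) + p^c`. x1-w8's generic `lambdaInvariant_le_zpCorank_grSelmer_add_pow`
fed §1 (`D_v̄` trivial on `(F/𝒪)(θquot)`) and the anticyclotomic generator of `ker κ ⊓ D_v̄` modulo inertia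
(`exists_generator_kerSubgroup_inf_decomp_of_isAnticyclotomic`). [cite: KellerYin2024, §1.4 (arXiv:2402.12781v2 TeX L1240–1260) and Rem. 1.2.2]
[cite: Greenberg1989, §1 p. 98] [cite: GreenbergVatsal2000, §2 pp. 14–15] -/
theorem lambdaInvariant_le_zpCorank_grSelmer_add_pow_quot_of_split (hp2 : p ≠ 2)
    (hsplitred : W.HasSplitMultiplicativeReductionAtPrime p) (hK : IsImaginaryQuadratic K)
    (hsplit : ((Ideal.span {(p : ℤ)}).primesOver (𝓞 K)).ncard = 2) {vbar : HeightOneSpectrum (𝓞 K)}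
    (hvbar : ((p : ℕ) : 𝓞 K) ∈ vbar.asIdeal) (hκ : κ.IsAnticyclotomic) {γ : absoluteGaloisGroup K}
    {θsub θquot : FramedGaloisRep K (padicCoeffIntegers (∅ : Set (PadicAlgCl p))) 1}
    (hpair : IsResidualPairOver (W.baseChange K) p θsub θquot)
    (hram : ∃ τ ∈ decomp vbar, unitChar θsub τ ≠ 1) (S₀ : Set (HeightOneSpectrum (𝓞 K)))
    (c : ℕ) (τ : ℕ → absoluteGaloisGroup K)
    (hreps : ∀ x : subgroupH1 κ.kerSubgroup (charModule (∅ : Set (PadicAlgCl p)) θquot),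
      (∀ i, i < p ^ c → resOfLe (charModule (∅ : Set (PadicAlgCl p)) θquot)
        (inf_le_left : κ.kerSubgroup ⊓ decomp vbar ≤ κ.kerSubgroup)
        (conjH1 κ.kerSubgroup (charModule (∅ : Set (PadicAlgCl p)) θquot) (τ i) x) = 0) →
        ∀ σ : absoluteGaloisGroup K, resOfLe (charModule (∅ : Set (PadicAlgCl p)) θquot)
          (inf_le_left : κ.kerSubgroup ⊓ decomp vbar ≤ κ.kerSubgroup)
          (conjH1 κ.kerSubgroup (charModule (∅ : Set (PadicAlgCl p)) θquot) σ x) = 0)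
    (DSquot : DatumDualData κ γ (charModule (∅ : Set (PadicAlgCl p)) θquot)
      (AcSelmer.bdpData (charModule (∅ : Set (PadicAlgCl p)) θquot) p vbar) S₀)
    [Module.Finite (IwasawaAlgebra p) DSquot.X] (htor : Module.IsTorsion (IwasawaAlgebra p) DSquot.X)
    (hμ : muInvariant p DSquot.X = 0) :
    lambdaInvariant p DSquot.X ≤
      zpCorank ↥(grSelmer κ (charModule (∅ : Set (PadicAlgCl p)) θquot) vbar S₀) p + p ^ c :=
  lambdaInvariant_le_zpCorank_grSelmer_add_pow κ vbar S₀ θquot hvbar c τ hreps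
    (fun _ hg x ↦ smul_charModule_quot_eq_of_mem_decomp_of_split W K vbar hsplitred hK hsplit hvbar hpair hram hg x)
    (exists_generator_kerSubgroup_inf_decomp_of_isAnticyclotomic κ hK hp2 hκ hvbar) DSquot htor hμ

/-- **(B1) at the split datum with the cotorsion facts in the `∀ D` form**, instantiated at `DSquot`.
[cite: KellerYin2024, Thm. 1.4.1 (i)–(iii) (arXiv:2402.12781v2 TeX L1087–1098)] -/
theorem lambdaInvariant_le_zpCorank_grSelmer_add_pow_quot_of_split_of_forall (hp2 : p ≠ 2)
    (hsplitred : W.HasSplitMultiplicativeReductionAtPrime p) (hK : IsImaginaryQuadratic K)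
    (hsplit : ((Ideal.span {(p : ℤ)}).primesOver (𝓞 K)).ncard = 2) {vbar : HeightOneSpectrum (𝓞 K)}
    (hvbar : ((p : ℕ) : 𝓞 K) ∈ vbar.asIdeal) (hκ : κ.IsAnticyclotomic) {γ : absoluteGaloisGroup K}
    {θsub θquot : FramedGaloisRep K (padicCoeffIntegers (∅ : Set (PadicAlgCl p))) 1}
    (hpair : IsResidualPairOver (W.baseChange K) p θsub θquot)
    (hram : ∃ τ ∈ decomp vbar, unitChar θsub τ ≠ 1) (S₀ : Set (HeightOneSpectrum (𝓞 K)))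
    (c : ℕ) (τ : ℕ → absoluteGaloisGroup K)
    (hreps : ∀ x : subgroupH1 κ.kerSubgroup (charModule (∅ : Set (PadicAlgCl p)) θquot),
      (∀ i, i < p ^ c → resOfLe (charModule (∅ : Set (PadicAlgCl p)) θquot)
        (inf_le_left : κ.kerSubgroup ⊓ decomp vbar ≤ κ.kerSubgroup)
        (conjH1 κ.kerSubgroup (charModule (∅ : Set (PadicAlgCl p)) θquot) (τ i) x) = 0) →
        ∀ σ : absoluteGaloisGroup K, resOfLe (charModule (∅ : Set (PadicAlgCl p)) θquot)
          (inf_le_left : κ.kerSubgroup ⊓ decomp vbar ≤ κ.kerSubgroup)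
          (conjH1 κ.kerSubgroup (charModule (∅ : Set (PadicAlgCl p)) θquot) σ x) = 0)
    (DSquot : DatumDualData κ γ (charModule (∅ : Set (PadicAlgCl p)) θquot)
      (AcSelmer.bdpData (charModule (∅ : Set (PadicAlgCl p)) θquot) p vbar) S₀)
    (hSquot : ∀ D : DatumDualData κ γ (charModule (∅ : Set (PadicAlgCl p)) θquot)
        (AcSelmer.bdpData (charModule (∅ : Set (PadicAlgCl p)) θquot) p vbar) S₀,
      Module.Finite (IwasawaAlgebra p) D.X ∧ Module.IsTorsion (IwasawaAlgebra p) D.X ∧ muInvariant p D.X = 0) :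
    lambdaInvariant p DSquot.X ≤
      zpCorank ↥(grSelmer κ (charModule (∅ : Set (PadicAlgCl p)) θquot) vbar S₀) p + p ^ c := by
  obtain ⟨hfg, htor, hμ⟩ := hSquot DSquot
  haveI := hfg
  exact lambdaInvariant_le_zpCorank_grSelmer_add_pow_quot_of_split W κ hp2 hsplitred hK hsplit hvbar hκ hpair hram S₀ c τ
    hreps DSquot htor hμ

end QuotBound

/-! ## §4. The `λ`-inequality from the mid-level index identity at the SPLIT datum -/

section LambdaLE

/-- **The `λ`-inequality of the V21 index road AT A SPLIT MULTIPLICATIVE DATUM, orientation (ω, 𝟙), from the mid-level identity.** On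
`W/ℚ` globally minimal, `2 < p` SPLIT multiplicative, `K` imaginary quadratic with `(p)` split, `v̄ ∋ p`, `κ` anticyclotomic with topological
generator `γ`, `(θsub, θquot)` a residual pair of `E_K[p]` with `θsub` RAMIFIED at `v̄` (some `τ ∈ I_v̄`, `θsub(τ) ≠ 1` — the residual line is
the Tate line), `Sf` a finite set of places with `w ∈ Sf ↔ N_W ∈ w` (x1's convention; at `p ∣ N` it contains the places above `p`, which
no Selmer condition of the road reads), dual data `DSsub`, `DSquot`, representatives `τ i` (`i < p^c`) for `(F/𝒪)(θquot)` above `v̄`, and the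
cotorsion facts (`𝔛^{Sf}_f` f.g. torsion `μ = 0`; `∀ D` for both characters): the identity
`zpCorank R(E_K[p^∞]) + ε = zpCorank R((F/𝒪)(θsub)) + zpCorank R((F/𝒪)(θquot)) + p^c` IMPLIES
`λ(DSsub.X) + λ(DSquot.X) ≤ λ(𝔛^{Sf}_f) + ε`, `ε = [θquot = 𝟙]`. Parts: (C) x1-w5's dictionary
`finite_torsionBy_and_lambdaInvariant_XAc_eq_zpCorank_datumStrictSelmer`; (B2) §2 at `θsub`; (B1) §3; then `omega` — x1-w8's
`lambdaInvariant_add_le_of_mid` with `Anom` / «no unramified rational line» replaced by the split orientation.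
[cite: KellerYin2024, Thm. 1.4.1 (iii) and §1.4 (arXiv:2402.12781v2 TeX L1087–1098, L1240–1260), §5.1] [cite: GreenbergVatsal2000, §2 pp. 14–15] -/
theorem lambdaInvariant_add_le_of_mid_split
    (W : WeierstrassCurve ℚ) [W.IsElliptic] [W.IsGloballyMinimal] (p : ℕ) [Fact p.Prime]
    (hp : 2 < p) (hsplitred : W.HasSplitMultiplicativeReductionAtPrime p)
    (K : Type) [Field K] [NumberField K] (hK : IsImaginaryQuadratic K)
    (hsplit : ((Ideal.span {(p : ℤ)}).primesOver (𝓞 K)).ncard = 2)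
    (vbar : HeightOneSpectrum (𝓞 K)) (hvbar : ((p : ℕ) : 𝓞 K) ∈ vbar.asIdeal)
    (κ : ZpExtension K p) (hκ : κ.IsAnticyclotomic)
    (γ : absoluteGaloisGroup K) [Fact (κ.IsTopGenerator γ)]
    (θsub θquot : FramedGaloisRep K (padicCoeffIntegers (∅ : Set (PadicAlgCl p))) 1)
    (hpair : IsResidualPairOver (W.baseChange K) p θsub θquot)
    (hramI : ∃ τ ∈ inertia vbar, unitChar θsub τ ≠ 1)
    (Sf : Finset (HeightOneSpectrum (𝓞 K)))
    (hSf : ∀ w : HeightOneSpectrum (𝓞 K), w ∈ Sf ↔ ((W.conductorNorm ℤ : ℤ) : 𝓞 K) ∈ w.asIdeal)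
    (DSsub : DatumDualData κ γ (charModule ∅ θsub)
        (AcSelmer.bdpData (charModule ∅ θsub) p vbar) (↑Sf : Set (HeightOneSpectrum (𝓞 K))))
    (DSquot : DatumDualData κ γ (charModule ∅ θquot)
        (AcSelmer.bdpData (charModule ∅ θquot) p vbar) (↑Sf : Set (HeightOneSpectrum (𝓞 K))))
    (c : ℕ) (τ : ℕ → absoluteGaloisGroup K)
    (hreps : ∀ x : subgroupH1 κ.kerSubgroup (charModule ∅ θquot),
      (∀ i, i < p ^ c → resOfLe (charModule ∅ θquot) (inf_le_left : κ.kerSubgroup ⊓ decomp vbar ≤ κ.kerSubgroup)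
        (conjH1 κ.kerSubgroup (charModule ∅ θquot) (τ i) x) = 0) →
        ∀ σ : absoluteGaloisGroup K, resOfLe (charModule ∅ θquot)
          (inf_le_left : κ.kerSubgroup ⊓ decomp vbar ≤ κ.kerSubgroup)
          (conjH1 κ.kerSubgroup (charModule ∅ θquot) σ x) = 0)
    (hmid : zpCorank (datumStrictSelmer κ.kerSubgroup ↥((W.baseChange K).geomPrimaryTorsion p) p
        (AcSelmer.bdpData ↥((W.baseChange K).geomPrimaryTorsion p) p vbar) (↑Sf : Set (HeightOneSpectrum (𝓞 K)))) p +
        (if ∀ σ : absoluteGaloisGroup K, θquot σ = 1 then 1 else 0) =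
      zpCorank (datumStrictSelmer κ.kerSubgroup (charModule ∅ θsub) p (AcSelmer.bdpData (charModule ∅ θsub) p vbar)
          (↑Sf : Set (HeightOneSpectrum (𝓞 K)))) p +
        zpCorank (datumStrictSelmer κ.kerSubgroup (charModule ∅ θquot) p
          (AcSelmer.bdpData (charModule ∅ θquot) p vbar) (↑Sf : Set (HeightOneSpectrum (𝓞 K)))) p + p ^ c)
    [Module.Finite (IwasawaAlgebra p) (AcSelmer.XAc (W.baseChange K) p κ vbar (↑Sf : Set (HeightOneSpectrum (𝓞 K))) γ)]
    (htorS : Module.IsTorsion (IwasawaAlgebra p)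
      (AcSelmer.XAc (W.baseChange K) p κ vbar (↑Sf : Set (HeightOneSpectrum (𝓞 K))) γ))
    (hμS : muInvariant p (AcSelmer.XAc (W.baseChange K) p κ vbar (↑Sf : Set (HeightOneSpectrum (𝓞 K))) γ) = 0)
    (hSsub : ∀ D : DatumDualData κ γ (charModule ∅ θsub)
        (AcSelmer.bdpData (charModule ∅ θsub) p vbar) (↑Sf : Set (HeightOneSpectrum (𝓞 K))),
      Module.Finite (IwasawaAlgebra p) D.X ∧ Module.IsTorsion (IwasawaAlgebra p) D.X ∧ muInvariant p D.X = 0)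
    (hSquot : ∀ D : DatumDualData κ γ (charModule ∅ θquot)
        (AcSelmer.bdpData (charModule ∅ θquot) p vbar) (↑Sf : Set (HeightOneSpectrum (𝓞 K))),
      Module.Finite (IwasawaAlgebra p) D.X ∧ Module.IsTorsion (IwasawaAlgebra p) D.X ∧ muInvariant p D.X = 0) :
    lambdaInvariant p DSsub.X + lambdaInvariant p DSquot.X ≤
      lambdaInvariant p (AcSelmer.XAc (W.baseChange K) p κ vbar (↑Sf : Set (HeightOneSpectrum (𝓞 K))) γ) +
        (if ∀ σ : absoluteGaloisGroup K, θquot σ = 1 then 1 else 0) := by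
  have hp2 : p ≠ 2 := by omega
  have hθsub : ∀ σ : absoluteGaloisGroup K, θsub σ ^ (p - 1) = 1 := fun σ ↦ (hpair.pow_sub_one σ).1
  have hram : ∃ τ ∈ decomp vbar, unitChar θsub τ ≠ 1 := by
    obtain ⟨τ, hτ, hne⟩ := hramI
    exact ⟨τ, GreenbergSelmer.inertia_le_decomp vbar hτ, hne⟩
  -- (C): `λ(𝔛^{Sf}_f) = zpCorank R(E_K[p^∞])`
  obtain ⟨-, hC⟩ := IndexPlumbingDictionary.finite_torsionBy_and_lambdaInvariant_XAc_eq_zpCorank_datumStrictSelmer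
    W p K vbar κ Sf hK hvbar γ hSf htorS hμS
  -- (B2): `λ(DSsub.X) = zpCorank R(θsub)`
  have hB2 := lambdaInvariant_eq_zpCorank_grSelmer_of_ramified_of_forall κ vbar (↑Sf : Set (HeightOneSpectrum (𝓞 K))) θsub
    hθsub hramI DSsub hSsub
  -- (B1): `λ(DSquot.X) ≤ zpCorank R(θquot) + p^c`
  have hB1 := lambdaInvariant_le_zpCorank_grSelmer_add_pow_quot_of_split_of_forall W κ hp2 hsplitred hK hsplit hvbar hκ hpair
    hram (↑Sf : Set (HeightOneSpectrum (𝓞 K))) c τ hreps DSquot hSquot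
  change lambdaInvariant p DSsub.X = zpCorank ↥(datumStrictSelmer κ.kerSubgroup (charModule ∅ θsub) p
    (AcSelmer.bdpData (charModule ∅ θsub) p vbar) (↑Sf : Set (HeightOneSpectrum (𝓞 K)))) p at hB2
  change lambdaInvariant p DSquot.X ≤ zpCorank ↥(datumStrictSelmer κ.kerSubgroup (charModule ∅ θquot) p
    (AcSelmer.bdpData (charModule ∅ θquot) p vbar) (↑Sf : Set (HeightOneSpectrum (𝓞 K)))) p + p ^ c at hB1
  omega

end LambdaLE

end Summit.BirchSwinnertonDyer.BirchSwinnertonDyer.Theorems.SplitMultIndexPlumbing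

end
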